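import Summits.CriticalPhenomena.CardyFormulaZ2.Theses.CardyMagicRigidity
import Literature.Probability.Percolation.QuadCrossingRotationInvariance
import Literature.Probability.Percolation.QuadCrossingSpaceZ2
import Literature.Probability.LatticeModels.TriangularLattice

/-!
# Sketch — crux-ideate stmt-CriticalPhenomena-4837 (LoopsToCrossings), ideator 1, round 1

First lemmas of the idea cards of ideator 1 (statements only; they elaborate, they are not proved):
* `OneSidedShorteningTransfer` — card `cluster-shadowing`;
* `BRSandwichZ2`, `tame_reduction` — card `br-sandwich-diagonal`;
* `TameLawIdentification` — variant `tame-law-identification`, NOT filed as a card (dominated; recorded in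
  the ideator's NOTES.md), kept here because its vocabulary (`triQuadConfig`, `triQuadLaw`) is reusable.
`X` below is literally the hypothesis of the crux (= the route's target `LoopLimitZ2EqT`).
-/

noncomputable section

namespace Summit.CriticalPhenomena.CardyFormulaZ2.Cruxes.LoopsToCrossings.Sketch

open Filter Set Topology MeasureTheory
open Literature.Probability.Percolation Literature.Probability.LatticeModels
open Literature.Probability.RandomPlanarGeometry
open Summit.CriticalPhenomena.CardyFormulaZ2.Theses.CardyMagicRigidity

/-! ### Vocabulary used by the cards (inline; candidates for definition requests) -/

/-- The drawn open set of a SITE configuration on `δ𝕋`: open sites and the segments between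
adjacent open sites (site analogue of `openEdgeUnion δ ω`). -/
def triOpenEdgeUnion (δ : ℝ) (ω : SiteConfig (Site 2)) : Set ℂ :=
  {z | ∃ x y : Site 2, triGraph.Adj x y ∧ x ∈ ω ∧ y ∈ ω ∧
      z ∈ segment ℝ (triMeshPoint δ x) (triMeshPoint δ y)} ∪
    {z | ∃ x : Site 2, x ∈ ω ∧ z = triMeshPoint δ x}

/-- Schramm–Smirnov crossing event of the conformal rectangle `R` for site percolation on `δ𝕋`
(site analogue of `quadCrossing R δ`): a path in `closure Ω ∩ (drawn open set)` from `arc 0`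
to `arc 2`. -/
def triQuadCrossing (R : ConformalRectangle) (δ : ℝ) : Set (SiteConfig (Site 2)) :=
  {ω | ∃ a ∈ R.arc 0, ∃ b ∈ R.arc 2, JoinedIn (closure R.carrier ∩ triOpenEdgeUnion δ ω) a b}

/-- Its `P_{1/2}`-probability on `𝕋`. -/
def triQuadCrossingProb (δ : ℝ) (R : ConformalRectangle) : ℝ :=
  (triSitePercolation half).real (triQuadCrossing R δ)

/-- `R'` is an INNER SHORTENING of `R`: a conformal sub-rectangle whose marked sides are
crosscuts of `Ω` at positive distance from the marked arcs of `R`, dominated in the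
Schramm–Smirnov sense (every crossing path of `R` contains a crossing of `R'`). -/
def IsInnerShortening (R R' : ConformalRectangle) : Prop :=
  R'.carrier ⊆ R.carrier ∧ Disjoint (R'.arc 0 ∪ R'.arc 2) (R.arc 0 ∪ R.arc 2) ∧
    ∀ (a b : ℂ) (γ : Path a b), a ∈ R.arc 0 → b ∈ R.arc 2 →
      Set.range γ ⊆ closure R.carrier →
        ∃ t₁ t₂ : unitInterval, t₁ ≤ t₂ ∧ γ t₁ ∈ R'.arc 0 ∧ γ t₂ ∈ R'.arc 2 ∧
          ∀ t ∈ Set.Icc t₁ t₂, γ t ∈ closure R'.carrier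

/-- The hypothesis `X` of the crux, by name (the route's target). -/
abbrev X : Prop := LoopLimitZ2EqT

/-! ### Card `cluster-shadowing`: first lemma -/

/-- FIRST LEMMA (card `cluster-shadowing`). One-sided, lossy transfer into inner shortenings,
in both lattice directions: under `X`, a bond-`ℤ²` crossing of `R` forces (up to `ε`) a
site-`𝕋` crossing of any inner shortening `R'` of `R`, and symmetrically. Content = the
cluster-shadowing lemma + bulk regularity (window one-arm, polychromatic six-arm no-hugging) +
the separation lemma near the four crosscut endpoints. -/
def OneSidedShorteningTransfer : Prop :=
  X → ∀ R R' : ConformalRectangle, IsInnerShortening R R' → ∀ ε : ℝ, 0 < ε →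
    ∀ᶠ δ in 𝓝[>] (0 : ℝ),
      quadCrossingProb δ R ≤ triQuadCrossingProb δ R' + ε ∧
        triQuadCrossingProb δ R ≤ quadCrossingProb δ R' + ε

/-! ### Card `br-sandwich-diagonal`: first lemma -/

/-- A conformal rectangle is TAME if its boundary is locally polygonal off a finite set of
parameters (BR's comparison domains `G^±_ε` are genuinely polygonal). -/
def IsTame (P : ConformalRectangle) : Prop :=
  ∃ T : Set ℝ, (T ∩ Set.Ico 0 1).Finite ∧ ∀ t : ℝ, t ∉ T →
    ∃ ε > (0 : ℝ), ∃ a b : ℂ, ∀ u ∈ Set.Ioo (t - ε) (t + ε),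
      P.boundary u ∈ segment ℝ a (P.boundary t) ∪ segment ℝ (P.boundary t) b

/-- FIRST LEMMA (card `br-sandwich-diagonal`). Bollobás–Riordan's sandwich (19) transplanted to
the bond-`ℤ²` G02 event with TAME, mesh-independent comparison rectangles whose Cardy values
are `ε`-close to that of `R` (the modulus continuity being extracted from the tree's
`IsDiscreteApprox` convergence by a slow diagonal), the `o(1)` being corner one-arm terms. -/
def BRSandwichZ2 : Prop :=
  ∀ (R : ConformalRectangle) (φ : ConformalEquiv UpperHalfPlane.upperHalfPlaneSet R.carrier)
    (x : Fin 4 → ℝ), R.IsUniformizing φ x → ∀ ε : ℝ, 0 < ε →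
      ∃ (Pm Pp : ConformalRectangle)
        (φm : ConformalEquiv UpperHalfPlane.upperHalfPlaneSet Pm.carrier) (xm : Fin 4 → ℝ)
        (φp : ConformalEquiv UpperHalfPlane.upperHalfPlaneSet Pp.carrier) (xp : Fin 4 → ℝ),
        IsTame Pm ∧ IsTame Pp ∧ Pm.IsUniformizing φm xm ∧ Pp.IsUniformizing φp xp ∧
          |cardyFunction (crossRatio xm) - cardyFunction (crossRatio x)| ≤ ε ∧
          |cardyFunction (crossRatio xp) - cardyFunction (crossRatio x)| ≤ ε ∧
          ∀ᶠ δ in 𝓝[>] (0 : ℝ),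
            bondDomainCrossingProb Pm δ - ε ≤ bondDomainCrossingProb R δ ∧
              bondDomainCrossingProb R δ ≤ bondDomainCrossingProb Pp δ + ε

/-- Tame universality: the crux restricted to tame rectangles (the residual of the card). -/
def TameUniversality : Prop :=
  X → ∀ P : ConformalRectangle, IsTame P →
    Tendsto (fun δ : ℝ ↦ bondDomainCrossingProb P δ - triDomainCrossingProb P δ)
      (𝓝[>] 0) (𝓝 0)

/-- The reduction the card claims (assembly; provable from the two Props, Smirnov-in-tree
`hasCrossingLimit_triDomainCrossingProb_holds` and continuity/monotonicity of `cardyFunction`). -/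
def tame_reduction : Prop :=
  BRSandwichZ2 → TameUniversality → LoopsToCrossings

/-! ### Variant `tame-law-identification` (not filed): statement -/

/-- The quads crossed by the drawn open set of a site configuration on `δ𝕋`, as a point of the
Schramm–Smirnov space `ℋ_D` (site analogue of `z2QuadConfig`). -/
def triQuadConfig (D : Set ℂ) (δ : ℝ) (ω : SiteConfig (Site 2)) : QuadCrossing.QuadConfig D :=
  QuadCrossing.QuadConfig.ofDominatedLower
    {Q | ∃ K ⊆ triOpenEdgeUnion δ ω, Q.IsCrossing K}
    (fun Q hQ Q' hdom ↦ by
      obtain ⟨K, hKU, hK⟩ := hQ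
      obtain ⟨K', hK'K, hK'⟩ := hdom K hK
      exact ⟨K', hK'K.trans hKU, hK'⟩)

/-- The law on `ℋ_D` of the quads crossed by critical site percolation on `δ𝕋`. -/
def triQuadLaw (D : Set ℂ) (δ : ℝ) : Measure (QuadCrossing.QuadConfig D) :=
  (triSitePercolation half).map (triQuadConfig D δ)

/-- FIRST LEMMA (card `tame-law-identification`). Under `X`, any joint subsequential
Schramm–Smirnov scaling limits of bond-`ℤ²` and site-`𝕋` coincide as laws on `ℋ_ℂ`
(identification on the π-system of finite intersections of crossing events of PL quads, which
generates the Borel σ-field by Schramm–Smirnov Thm 1.4 (2)). -/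
def TameLawIdentification : Prop :=
  X → ∀ (μ ν : Measure (QuadCrossing.QuadConfig (Set.univ : Set ℂ))) (δs : ℕ → ℝ),
    (∀ k, 0 < δs k) → Tendsto δs atTop (𝓝 0) →
      IsProbabilityMeasure μ → IsProbabilityMeasure ν →
        (∀ f : QuadCrossing.QuadConfig (Set.univ : Set ℂ) → ℝ, Continuous f →
          (∃ C, ∀ S, |f S| ≤ C) →
            Tendsto (fun k ↦ ∫ S, f S ∂((z2QuadLaw Set.univ (δs k) :
              FiniteMeasure (QuadCrossing.QuadConfig (Set.univ : Set ℂ))) :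
                Measure (QuadCrossing.QuadConfig (Set.univ : Set ℂ))))
              atTop (𝓝 (∫ S, f S ∂μ)) ∧
            Tendsto (fun k ↦ ∫ S, f S ∂(triQuadLaw Set.univ (δs k))) atTop (𝓝 (∫ S, f S ∂ν))) →
        μ = ν

end Summit.CriticalPhenomena.CardyFormulaZ2.Cruxes.LoopsToCrossings.Sketch

end
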